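import Summits.BirchSwinnertonDyer.BirchSwinnertonDyer.Theorems.SylvesterTwoHeegnerIndexUpperOffV0ShaBoundTwoSharp
import Summits.BirchSwinnertonDyer.BirchSwinnertonDyer.Theorems.SylvesterTwoHeegnerIndexUpperOffV0ShaBoundTwoRat
import Summits.BirchSwinnertonDyer.BirchSwinnertonDyer.Theorems.SylvesterTwoHeegnerIndexUpperOffV0ShaBoundTwoOmega
import HarnessLib

/-!
# K7t crux `UpperOffV0HSYPlus` (item 19804), line `offv0-kolyvagin2`: what the registered stub (d″)
# and the finset leaf (e_T) give IN KERNEL for `E_p` — `Ш(E_p/K)[2^∞]` and `Ш(E_p/ℚ)[2^∞]` killed by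
# `2^{M₀+2}` (the SHARP twin of `…ShaBoundTwoSylvester` / `…ShaBoundTwoRat`, exponent `2^{2M₀+4}`)

Route `SylvesterTwoHeegnerIndex` (cell bsd-cm, rung K7t), registered VARIANT E skeleton on
stmt-BirchSwinnertonDyer-19804 (planner g22, D135), stub (U1)
`stub_shaTwoExponentSharpOffV0B_of_kolyvaginDescent_two : (d″) → (e) → (… 2^e Ш(E_p/ℚ)[2^∞] = 0,
2e ≤ ord₂ #Ш_an(E_p))`.  This file takes the TEXT of (d″) `stub_kolyvaginClasses_two` VERBATIM
(binder `hD`) and the finset form (e_T) of (e) (binder `hET`: the conclusion of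
`kolyvaginReciprocityFinset_two_of_poitouTate`, `…UpperOffV0ReciprocityFinsetTwoOfPoitouTate`; same
Poitou–Tate footing as (e); `T = ∅` is (e) verbatim) and derives, for every globally minimal model `W`
of `E_p = cubeSumCurve p` (`p` an odd prime) at its conductor `N` with `3 ∣ N`, every imaginary
quadratic Heegner field `K` (`d_K ∉ {-3,-4}`) and every Heegner point `P ∈ E_p(K)` of level `N` of
infinite order, with `2^{M₀} ∥ P` in `E_p(K)`:

* `sha_two_exponent_bound_sharp_sylvester_of_stubs` — **`Ш(E_p/K)[2^∞]` finite and killed by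
  `2^{M₀+2}`** (`sha_two_primary_exponent_sharp_of_pointsM_of_reciprocityFinsetM`; `E_p(K)[2] = 0`,
  `∛(432p²) ∉ K`, `ω ∉ K` discharged as in the landed twins);
* `sha_two_exponent_bound_sharp_sylvester_rat_of_stubs` — in a twist-rank-`0` frame
  (`rank E_p^{(d_K)}(ℚ) = 0`, i.e. every Heegner frame of the route), **`Ш(E_p/ℚ)[2^∞]` finite and
  killed by `2^{M₀+2}`** (transport along `Ш(E_p/ℚ) ↪ Ш(E_p/K)`, k7t-c2 g0/g5).

HONEST FRAMING — what this says about stub (U1).  In such a frame Gross–Zagier against the two BSD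
formulae reads `2M₀ = ord₂ #Ш_an(E_p) + ord₂ #Ш_an(E_p^{(d_K)}) + 2t_K` (`t_K` = Tamagawa-at-3 /
Manin / index bookkeeping of the frame), so the exponent `e = M₀ + 2` proved here satisfies
`2e = ord₂ #Ш_an(E_p) + [ord₂ #Ш_an(E_p^{(d_K)}) + 2t_K + 4]`: (U1)'s `2e ≤ ord₂ #Ш_an(E_p)` is missed
by `4 + ord₂ #Ш_an(E_p^{(d_K)}) + 2t_K ≥ 4` in EVERY frame.  The `+2` in the exponent is intrinsic to
`τ`-eigen Heegner classes (g5 §5 / g7 ISOTROPY p494364); the twist term is invisible to any EXPONENT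
statement (an exponent bound over `K` bounds `max`, not `sum`, of the exponents of `Ш(E_p)` and
`Ш(E_p^{(d_K)})`).  So (U1) is not reachable along the line even after this sharpening; see the seat
memo K7T-UPPER-SHARP-k7t-c2-g8.md for the typed re-cut offered to the planner.  No named fact, no
definition, no `sorry`; B14 = O12 open as a class; BSD not claimed.
-/

noncomputable section

open scoped Classical
open WeierstrassCurve NumberField IsDedekindDomain Field Literature.NumberTheory.EllipticCurves
  Literature.NumberTheory.EllipticCurves.HuShuYin2019 Literature.NumberTheory.GaloisRepresentations

set_option autoImplicit false
set_option linter.dupNamespace false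

namespace Summit.BirchSwinnertonDyer.BirchSwinnertonDyer.Theorems.SylvesterTwoUpper

/-- **(d″) + (e_T) ⟹ `2^{M₀+2} Ш(E_p/K)[2^∞] = 0` for the Sylvester curves.**  The hypothesis `hD` is
the registered signature of `stub_kolyvaginClasses_two` (VARIANT E) VERBATIM, `hET` the finset leaf
(e_T); the conclusion is Kolyvagin's theorem at `p = 2` in exponent form, SHARP
(`sha_two_primary_exponent_sharp_of_pointsM_of_reciprocityFinsetM`), for every globally minimal model
`W` of `cubeSumCurve p` (`p` an odd prime) at its conductor `N` with `3 ∣ N`, every imaginary quadratic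
Heegner field `K` with `d_K ∉ {-3, -4}`, and every Heegner point `P` of infinite order: `2^{M₀} ∥ P` in
`E_p(K)`, `Ш(E_p/K)[2^∞]` is finite and killed by `2^{M₀+2}`.
[cite: McCallumLMS1991, §1 Theorem (Kolyvagin), §2 Prop. 2.2] [cite: GrossLMS1991, Thm. 1.3 (2)] -/
theorem sha_two_exponent_bound_sharp_sylvester_of_stubs
    (hD : ∀ (N : ℕ) [NeZero N] (W : WeierstrassCurve ℚ) [W.IsElliptic] [W.IsGloballyMinimal] (_hN : N = W.conductorNorm ℤ) {p : ℕ} (_hp : p.Prime) (_hp2 : p ≠ 2) (_hW : ∃ C : WeierstrassCurve.VariableChange ℚ, C • W = HuShuYin2019.cubeSumCurve (p : ℚ)) (_h3N : 3 ∣ N) (K : Type) [Field K] [NumberField K] (_hK : IsImaginaryQuadratic K) (_hD : NumberField.discr K ≠ -3 ∧ NumberField.discr K ≠ -4) (_hH : SatisfiesHeegnerHypothesis N K) {P : (W.baseChange K).toAffine.Point} (_hP : IsHeegnerPoint N W K P) (_hnt : ¬ IsOfFinAddOrder P) {M : ℕ} (_hM : 1 ≤ M) (hdiv : ∀ Q :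 geomPoints (W.baseChange K), ∃ R, ((2 ^ M : ℕ) : ℤ) • R = Q) (c : K ≃ₐ[ℚ] K) (_hc : c ≠ 1), ∃ (ε : ℤ) (τ : AlgebraicClosure K ≃+* AlgebraicClosure K) (hτ : IsLiftOfAut c τ) (A : ℕ → AddSubgroup (geomPoints (W.baseChange K))) (hA : ∀ m, KolyvaginCocycle.IsAdmissible (Field.absoluteGaloisGroup K) (A m) ((2 ^ M : ℕ) : ℤ)) (Pt : ℕ → geomPoints (W.baseChange K)) (hPt : ∀ m, Pt m ∈ KolyvaginCocycle.invPoints (Field.absoluteGaloisGroup K) (A m) ((2 ^ M : ℕ) : ℤ)), (ε = 1 ∨ ε = -1) ∧ IsOfFinAddOrder (Affine.Point.map (W' := W) (c : K →ₐ[ℚ] K) P - ε • P) ∧ (∀ m, ∀ a ∈ A m, hτ.pointsMap W a ∈ A m) ∧ Pt 1 = toGeomPoints (W.baseChange K) P ∧ (∀ m : ℕ, Squarefree m → (∀ q ∈ m.primeFactors, IsKolyvaginPrime N W K 2 q ∧ FrobEqFrobInfty W K (2 ^ M) q) → (∃ B ∈ A m, hτ.pointsMap W (Pt m) = (ε * (-1)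 ^ m.primeFactors.card) • Pt m + ((2 ^ M : ℕ) : ℤ) • B) ∧ (∀ v : HeightOneSpectrum (𝓞 K), (m : 𝓞 K) ∉ v.asIdeal → kolyvaginClass (W.baseChange K) _ hdiv (hA m) (Pt m) (hPt m) ∈ selmerLocalKer (W.baseChange K) (v.adicCompletion K) ((2 ^ M : ℕ) : ℤ)) ∧ (∀ ℓ : ℕ, ℓ.Prime → ℓ ∣ m → ∀ v : HeightOneSpectrum (𝓞 K), (ℓ : 𝓞 K) ∈ v.asIdeal → ∀ a : ℕ, ((((2 : ℕ) : ℤ) ^ a) • kolyvaginClass (W.baseChange K) _ hdiv (hA m) (Pt m) (hPt m) ∈ selmerLocalKer (W.baseChange K) (v.adicCompletion K) ((2 ^ M : ℕ) : ℤ) ↔ (((2 : ℕ) : ℤ) ^ a) • kolyvaginClass (W.baseChange K) _ hdiv (hA (m / ℓ)) (Pt (m / ℓ)) (hPt (m / ℓ)) ∈ (W.baseChange K).torsionLocalKer (v.adicCompletion K) ((2 ^ M : ℕ) : ℤ)))))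
    (hET : ∀ (N : ℕ) [NeZero N] (W : WeierstrassCurve ℚ) [W.IsElliptic] (K : Type) [Field K] [NumberField K]
      (_hK : IsImaginaryQuadratic K) (_hD : NumberField.discr K ≠ -3 ∧ NumberField.discr K ≠ -4)
      (_hH : SatisfiesHeegnerHypothesis N K) {P : (W.baseChange K).toAffine.Point}
      (_hP : IsHeegnerPoint N W K P) (_hnt : ¬ IsOfFinAddOrder P) {M : ℕ} (_hM : 1 ≤ M) {ℓ : ℕ}
      (hℓ : IsKolyvaginPrime N W K 2 ℓ), FrobEqFrobInfty W K (2 ^ M) ℓ →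
      ∃ (A : Type) (_ : AddCommGroup A)
        (e : geomTorsion (W.baseChange K) ((2 ^ M : ℕ) : ℤ) →+
          geomTorsion (W.baseChange K) ((2 ^ M : ℕ) : ℤ) →+ A),
        (∀ x, e x x = 0) ∧ (∀ x, (∀ y, e x y = 0) → x = 0) ∧
        ∀ (T : Finset (HeightOneSpectrum (𝓞 K))),
        ∀ s ∈ selmerGroup (W.baseChange K) ((2 ^ M : ℕ) : ℤ),
          (∀ v ∈ T, s ∈ (W.baseChange K).torsionLocalKer (v.adicCompletion K) ((2 ^ M : ℕ) : ℤ)) →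
          ∀ c' : galH1Torsion (W.baseChange K) ((2 ^ M : ℕ) : ℤ),
          (∀ v : HeightOneSpectrum (𝓞 K), v ∉ T → (ℓ : 𝓞 K) ∉ v.asIdeal →
            c' ∈ selmerLocalKer (W.baseChange K) (v.adicCompletion K) ((2 ^ M : ℕ) : ℤ)) →
          (∀ w : InfinitePlace K,
            c' ∈ selmerLocalKer (W.baseChange K) w.Completion ((2 ^ M : ℕ) : ℤ)) →
          ∀ 𝔔 ∈ hℓ.place.primesAbove, ∀ F : Field.absoluteGaloisGroup K,
            IsArithFrobAt (𝓞 K) F 𝔔 →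
            F ∈ torsionFixing (W.baseChange K) ((2 ^ M : ℕ) : ℤ) →
            ∀ σ ∈ 𝔔.inertia (Field.absoluteGaloisGroup K),
            e (h1Eval (W.baseChange K) ((2 ^ M : ℕ) : ℤ) s F)
              (h1Eval (W.baseChange K) ((2 ^ M : ℕ) : ℤ) c' σ) = 0)
    {p : ℕ} (hp : p.Prime) (hp2 : p ≠ 2) {N : ℕ} [NeZero N] (W : WeierstrassCurve ℚ) [W.IsElliptic]
    [W.IsGloballyMinimal] (hN : N = W.conductorNorm ℤ)
    (hW : ∃ C : VariableChange ℚ, C • W = HuShuYin2019.cubeSumCurve (p : ℚ)) (h3N : 3 ∣ N)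
    {K : Type} [Field K] [NumberField K] (hK : IsImaginaryQuadratic K)
    (hdK : NumberField.discr K ≠ -3 ∧ NumberField.discr K ≠ -4) (hH : SatisfiesHeegnerHypothesis N K)
    {P : (W.baseChange K).toAffine.Point} (hP : IsHeegnerPoint N W K P) (hnt : ¬ IsOfFinAddOrder P) :
    ∃ (M₀ : ℕ) (x₀ : (W.baseChange K).toAffine.Point),
      2 ^ M₀ • x₀ = P ∧ (∀ Q : (W.baseChange K).toAffine.Point, 2 ^ (M₀ + 1) • Q ≠ P) ∧
      (∀ cs : (W.baseChange K).sha, (∃ j : ℕ, 2 ^ j • cs = 0) → 2 ^ (M₀ + 2) • cs = 0) ∧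
      Set.Finite {cs : (W.baseChange K).sha | ∃ j : ℕ, 2 ^ j • cs = 0} := by
  -- the Mordell model `C • W = y² = x³ − 432p²`, `∛(432p²) ∉ K`, `E_p(K)[2] = 0`, `ω ∉ K`
  obtain ⟨C, hCW⟩ := hW
  have hCW' : C • W = ⟨0, 0, 0, 0, -(432 * (p : ℚ) ^ 2)⟩ := by
    rw [hCW, HuShuYin2019.cubeSumCurve]; congr 1; ring
  have hcube : ∀ x : K, x ^ 3 ≠ ((432 * (p : ℚ) ^ 2 : ℚ) : K) := fun x h =>
    SylvesterTwoFrame.cube_ne_432_mul_sq_of_finrank_eq_two K hK.1 hp hp2 x (by rw [h]; simp)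
  have hA2 : ∀ a : (W.baseChange K).toAffine.Point, 2 • a = 0 → a = 0 :=
    SylvesterTwoFrame.two_torsion_eq_zero_of_model_of_isImaginaryQuadratic K hK hp hp2 W ⟨C, hCW⟩
  have hωK : ∀ x : K, x ^ 2 + x + 1 ≠ 0 := sq_add_self_add_one_ne_zero_of_discr_ne hK hdK.1
  exact sha_two_primary_exponent_sharp_of_pointsM_of_reciprocityFinsetM (N := N) W hK hCW' hcube hωK
    hA2 hP hnt
    (fun {M} hM hdiv c hc ↦ hD N W hN hp hp2 ⟨C, hCW⟩ h3N K hK hdK hH hP hnt hM hdiv c hc)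
    (fun {M} hM {ℓ} hℓ hℓM ↦ hET N W K hK hdK hH hP hnt hM hℓ hℓM)

/-- **(d″) + (e_T) ⟹ `2^{M₀+2} Ш(E_p/ℚ)[2^∞] = 0` in a twist-rank-`0` frame** (every Heegner frame of
the route: `L(E_p^{(d_K)}, 1) ≠ 0`): `sha_two_exponent_bound_sharp_sylvester_of_stubs` over `K`,
transported along the injection `Ш(E_p/ℚ) ↪ Ш(E_p/K)`
(`shaRestriction_injective_sylvester_of_twist_rank_zero`, `twoPrimary_exponent_of_injective`).  This
is the SHARPEST exponent the line's leaves give for `Ш(E_p/ℚ)[2^∞]`; by the frame identity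
`2M₀ = ord₂ #Ш_an(E_p) + ord₂ #Ш_an(E_p^{(d_K)}) + 2t_K` it misses stub (U1)'s
`2e ≤ ord₂ #Ш_an(E_p)` by `4 + ord₂ #Ш_an(E_p^{(d_K)}) + 2t_K`.
[cite: McCallumLMS1991, §1 Theorem (Kolyvagin)] [cite: GrossLMS1991, Thm. 1.3 (2), §2] -/
theorem sha_two_exponent_bound_sharp_sylvester_rat_of_stubs
    (hD : ∀ (N : ℕ) [NeZero N] (W : WeierstrassCurve ℚ) [W.IsElliptic] [W.IsGloballyMinimal] (_hN : N = W.conductorNorm ℤ) {p : ℕ} (_hp : p.Prime) (_hp2 : p ≠ 2) (_hW : ∃ C : WeierstrassCurve.VariableChange ℚ, C • W = HuShuYin2019.cubeSumCurve (p : ℚ)) (_h3N : 3 ∣ N) (K : Type) [Field K] [NumberField K] (_hK : IsImaginaryQuadratic K) (_hD : NumberField.discr K ≠ -3 ∧ NumberField.discr K ≠ -4) (_hH : SatisfiesHeegnerHypothesis N K) {P : (W.baseChange K).toAffine.Point} (_hP : IsHeegnerPoint N W K P) (_hnt : ¬ IsOfFinAddOrder P) {M : ℕ} (_hM : 1 ≤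 M) (hdiv : ∀ Q : geomPoints (W.baseChange K), ∃ R, ((2 ^ M : ℕ) : ℤ) • R = Q) (c : K ≃ₐ[ℚ] K) (_hc : c ≠ 1), ∃ (ε : ℤ) (τ : AlgebraicClosure K ≃+* AlgebraicClosure K) (hτ : IsLiftOfAut c τ) (A : ℕ → AddSubgroup (geomPoints (W.baseChange K))) (hA : ∀ m, KolyvaginCocycle.IsAdmissible (Field.absoluteGaloisGroup K) (A m) ((2 ^ M : ℕ) : ℤ)) (Pt : ℕ → geomPoints (W.baseChange K)) (hPt : ∀ m, Pt m ∈ KolyvaginCocycle.invPoints (Field.absoluteGaloisGroup K) (A m) ((2 ^ M : ℕ) : ℤ)), (ε = 1 ∨ ε = -1) ∧ IsOfFinAddOrder (Affine.Point.map (W' := W) (c : K →ₐ[ℚ] K) P - ε • P) ∧ (∀ m, ∀ a ∈ A m, hτ.pointsMap W a ∈ A m) ∧ Pt 1 = toGeomPoints (W.baseChange K) P ∧ (∀ m : ℕ, Squarefree m → (∀ q ∈ m.primeFactors, IsKolyvaginPrime N W K 2 q ∧ FrobEqFrobInfty W K (2 ^ M) q) → (∃ B ∈ A m, hτ.pointsMap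 W (Pt m) = (ε * (-1) ^ m.primeFactors.card) • Pt m + ((2 ^ M : ℕ) : ℤ) • B) ∧ (∀ v : HeightOneSpectrum (𝓞 K), (m : 𝓞 K) ∉ v.asIdeal → kolyvaginClass (W.baseChange K) _ hdiv (hA m) (Pt m) (hPt m) ∈ selmerLocalKer (W.baseChange K) (v.adicCompletion K) ((2 ^ M : ℕ) : ℤ)) ∧ (∀ ℓ : ℕ, ℓ.Prime → ℓ ∣ m → ∀ v : HeightOneSpectrum (𝓞 K), (ℓ : 𝓞 K) ∈ v.asIdeal → ∀ a : ℕ, ((((2 : ℕ) : ℤ) ^ a) • kolyvaginClass (W.baseChange K) _ hdiv (hA m) (Pt m) (hPt m) ∈ selmerLocalKer (W.baseChange K) (v.adicCompletion K) ((2 ^ M : ℕ) : ℤ) ↔ (((2 : ℕ) : ℤ) ^ a) • kolyvaginClass (W.baseChange K) _ hdiv (hA (m / ℓ)) (Pt (m / ℓ)) (hPt (m / ℓ)) ∈ (W.baseChange K).torsionLocalKer (v.adicCompletion K) ((2 ^ M : ℕ) : ℤ)))))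
    (hET : ∀ (N : ℕ) [NeZero N] (W : WeierstrassCurve ℚ) [W.IsElliptic] (K : Type) [Field K] [NumberField K]
      (_hK : IsImaginaryQuadratic K) (_hD : NumberField.discr K ≠ -3 ∧ NumberField.discr K ≠ -4)
      (_hH : SatisfiesHeegnerHypothesis N K) {P : (W.baseChange K).toAffine.Point}
      (_hP : IsHeegnerPoint N W K P) (_hnt : ¬ IsOfFinAddOrder P) {M : ℕ} (_hM : 1 ≤ M) {ℓ : ℕ}
      (hℓ : IsKolyvaginPrime N W K 2 ℓ), FrobEqFrobInfty W K (2 ^ M) ℓ →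
      ∃ (A : Type) (_ : AddCommGroup A)
        (e : geomTorsion (W.baseChange K) ((2 ^ M : ℕ) : ℤ) →+
          geomTorsion (W.baseChange K) ((2 ^ M : ℕ) : ℤ) →+ A),
        (∀ x, e x x = 0) ∧ (∀ x, (∀ y, e x y = 0) → x = 0) ∧
        ∀ (T : Finset (HeightOneSpectrum (𝓞 K))),
        ∀ s ∈ selmerGroup (W.baseChange K) ((2 ^ M : ℕ) : ℤ),
          (∀ v ∈ T, s ∈ (W.baseChange K).torsionLocalKer (v.adicCompletion K) ((2 ^ M : ℕ) : ℤ)) →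
          ∀ c' : galH1Torsion (W.baseChange K) ((2 ^ M : ℕ) : ℤ),
          (∀ v : HeightOneSpectrum (𝓞 K), v ∉ T → (ℓ : 𝓞 K) ∉ v.asIdeal →
            c' ∈ selmerLocalKer (W.baseChange K) (v.adicCompletion K) ((2 ^ M : ℕ) : ℤ)) →
          (∀ w : InfinitePlace K,
            c' ∈ selmerLocalKer (W.baseChange K) w.Completion ((2 ^ M : ℕ) : ℤ)) →
          ∀ 𝔔 ∈ hℓ.place.primesAbove, ∀ F : Field.absoluteGaloisGroup K,
            IsArithFrobAt (𝓞 K) F 𝔔 →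
            F ∈ torsionFixing (W.baseChange K) ((2 ^ M : ℕ) : ℤ) →
            ∀ σ ∈ 𝔔.inertia (Field.absoluteGaloisGroup K),
            e (h1Eval (W.baseChange K) ((2 ^ M : ℕ) : ℤ) s F)
              (h1Eval (W.baseChange K) ((2 ^ M : ℕ) : ℤ) c' σ) = 0)
    {p : ℕ} (hp : p.Prime) (hp2 : p ≠ 2) {N : ℕ} [NeZero N] (W : WeierstrassCurve ℚ) [W.IsElliptic]
    [W.IsGloballyMinimal] (hN : N = W.conductorNorm ℤ)
    (hW : ∃ C : VariableChange ℚ, C • W = HuShuYin2019.cubeSumCurve (p : ℚ)) (h3N : 3 ∣ N)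
    {K : Type} [Field K] [NumberField K] (hK : IsImaginaryQuadratic K)
    (hdK : NumberField.discr K ≠ -3 ∧ NumberField.discr K ≠ -4) (hH : SatisfiesHeegnerHypothesis N K)
    {P : (W.baseChange K).toAffine.Point} (hP : IsHeegnerPoint N W K P) (hnt : ¬ IsOfFinAddOrder P)
    (htwist : (W.quadraticTwist (NumberField.discr K : ℚ)).mordellWeilRank = 0) :
    ∃ (M₀ : ℕ) (x₀ : (W.baseChange K).toAffine.Point),
      2 ^ M₀ • x₀ = P ∧ (∀ Q : (W.baseChange K).toAffine.Point, 2 ^ (M₀ + 1) • Q ≠ P) ∧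
      (∀ cs : W.sha, (∃ j : ℕ, 2 ^ j • cs = 0) → 2 ^ (M₀ + 2) • cs = 0) ∧
      Set.Finite {cs : W.sha | ∃ j : ℕ, 2 ^ j • cs = 0} := by
  obtain ⟨M₀, x₀, hx₀, hmax, hkill, hfin⟩ :=
    sha_two_exponent_bound_sharp_sylvester_of_stubs hD hET hp hp2 W hN hW h3N hK hdK hH hP hnt
  have hinj : Function.Injective (shaRestriction W K) :=
    shaRestriction_injective_sylvester_of_twist_rank_zero hp hp2 W hW K hK.1 htwist
  obtain ⟨hkillQ, hfinQ⟩ :=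
    twoPrimary_exponent_of_injective (shaRestriction W K) hinj 2 (M₀ + 2) hkill hfin
  exact ⟨M₀, x₀, hx₀, hmax, hkillQ, hfinQ⟩

end Summit.BirchSwinnertonDyer.BirchSwinnertonDyer.Theorems.SylvesterTwoUpper

end
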